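import Summits.CriticalPhenomena.PercolationContinuityZ3.Theorems.Transplant.PlanarSkeletonFrmFromDefs
import Summits.CriticalPhenomena.PercolationContinuityZ3.Theorems.Transplant.SkelFrmFromBParamsSchedA
import Summits.CriticalPhenomena.PercolationContinuityZ3.Theorems.Transplant.SkelFrmBParamsSchedA
import Summits.CriticalPhenomena.PercolationContinuityZ3.Theorems.Transplant.SkelFrmFromBParamsExcess
import Summits.CriticalPhenomena.PercolationContinuityZ3.Theorems.Transplant.SkelFrmBParamsExcess
import Summits.CriticalPhenomena.PercolationContinuityZ3.Theorems.Transplant.SkelPhiFatRadius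
import Summits.CriticalPhenomena.PercolationContinuityZ3.Theorems.Transplant.SkelConcRootRadii
import Summits.CriticalPhenomena.PercolationContinuityZ3.Theorems.Transplant.SkelNegBParamsSlotsSU
import HarnessLib
import Summits.CriticalPhenomena.PercolationContinuityZ3.Theorems.Transplant.SkelFrmBParamsSlotsS
/-!
# U-WAVE PORT (RULING D-U, lead g21 2026-08-26; WAVE-U-MANIFEST v3.1 row «SkelFrmBParamsSlotsS» ↦ «SkelFrmFromBParamsSlotsS») of the tree module
# `Transplant/SkelFrmBParamsSlotsS` onto the carrier `PlanarSkeletonFrmFrom` (frames only, cylinders connected from width `ℓ₀` on)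

ORIGINAL TITLE: N2 (frames-only node `SamePDropOfSkeletonFrmFrom₁`, OPEN) params column over `PlanarSkeletonFrm` — (ζ″) ledger, part SlotsS: THE FIBRE-BLOCK SLOT VALUE OF RECORD OVER THE

builds on p205010 (kernel theorem, internal audit signed; external expert review pending) — nothing in this file uses p205010; NOTHING is claimed about the
OPEN node U `SamePDropOfSkeletonFrmFrom₁` (nor U_s / the end state).  Lane `prim-bschramm`, seat `prim-bschramm-stmt` gen 26 (port pen, RULING M-11 family P-stmt; tool = p3-g26's port_u.py of record, registry-driven inputs); helper file
(`--supports stmt-CriticalPhenomena-4575 --as helper`).  PORT RULES r1–r4 of RULING D-U: declaration order and proof texts are those of the original,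
byte-identical except (i) the carrier token `PlanarSkeletonFrm ↦ PlanarSkeletonFrmFrom` (binders, `namespace`/`end` lines, qualified names of twinned
declarations), (ii) carrier-FREE declarations of the original (φ-level `Skelφ…` blocks and namespace-only arithmetic residents) are NOT re-declared —
this file imports the original and `export`s the twin-free residents (POLICY T / treatment (m1)); residents whose statement mentions a twinned
constant are copied, (iii) every carrier-binding declaration keeps its explicit binder `(Φ : PlanarSkeletonFrmFrom G)` in its own signature (r2).  Docstrings and citations are the original's.
-/

noncomputable section

open scoped Classical

namespace Summit.CriticalPhenomena.PercolationContinuityZ3.Theorems.Transplant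

namespace PlanarSkeletonFrmFrom

namespace NegB

open MeasureTheory Literature.Probability.Percolation Literature.Probability.LatticeModels SimpleGraph
open Literature.Barriers.CriticalPhenomena (graphBall)
open SkelConc (Consts)
open BoxProdZ2 (ConcRadiiG Erad Frad nQ)
open Skelφ (oriφ trφ)
open Skelφ.StepI (DataN DataNS)
open Skel (excess)
open Neg

/-! ## §1 The residual slot type, the seed's fat radius, the φ-diameter of a rim habitat -/

/-- **A (g,f)-level residual slot**: a floor as a function of everything p-fixed AND the box/width values `(g, f)`. [this work] -/
def GSlot : Type 1 :=
  ∀ (κ : Consts) {V : Type} [DecidableEq V] [Countable V] {G : SimpleGraph V} [G.LocallyFinite], PlanarSkeletonFrmFrom G → V → unitInterval → Skelφ.StepI.DataNS V → ℕ → ℕ → ℕ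

/-- The zero residual. [folklore] -/
def GSlot.zero : GSlot := fun _ _ _ _ _ _ _ _ _ _ _ _ => 0

/-- **The seed's fat radius `ψπ := fatRadius Φ.frame hC D.k`** as a p-level number (`0` off `Φ.CylSubcritical p`). [cite: KozmaNitzan2024, §4 p. 16 (Lemma 9)] -/
def ψπ {V : Type} [Countable V] {G : SimpleGraph V} [G.LocallyFinite] (Φ : PlanarSkeletonFrmFrom G) (p : unitInterval) (D : DataNS V) : ℕ :=
  if h : Φ.CylSubcritical p then Skelφ.fatRadius Φ.frame h D.k else 0

/-- `ψπ = fatRadius Φ.frame hC D.k` under `hC`. [folklore] -/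
theorem ψπ_eq {V : Type} [Countable V] {G : SimpleGraph V} [G.LocallyFinite] (Φ : PlanarSkeletonFrmFrom G) {p : unitInterval} (hC : Φ.CylSubcritical p) (D : DataNS V) :
    ψπ Φ p D = Skelφ.fatRadius Φ.frame hC D.k := by
  unfold ψπ; rw [dif_pos hC]

section Values

variable (κ : Consts) {V : Type} [DecidableEq V] [Countable V] {G : SimpleGraph V} [G.LocallyFinite] (Φ : PlanarSkeletonFrmFrom G) (t : V)
  (p : unitInterval) (D : DataNS V) (g f mx : ℕ)

/-- **The φ-diameter of a rim habitat of the (ζ′) cells** (residual slot `mx`): `mRS := max (2·(n_L + ℓ_L + 3|h_L| + 1)·(50·fcellsA.rmax + 1)) mx`. [this work] -/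
def mRS (κ : Consts) {V : Type} [DecidableEq V] [Countable V] {G : SimpleGraph V} [G.LocallyFinite] (Φ : PlanarSkeletonFrmFrom G) (t : V) (p : unitInterval) (D : DataNS V) (g : ℕ) (f : ℕ) (mx : ℕ) : ℕ := max (2 * (nL κ Φ t p D g f + ℓL κ Φ t p D g f + 3 * (hL κ Φ t p D g f).natAbs + 1) * (50 * (fcellsA κ Φ t p D g f).rmax + 1)) mx

/-- The two floors inside `mRS`. [folklore] -/
theorem mRS_ge (κ : Consts) {V : Type} [DecidableEq V] [Countable V] {G : SimpleGraph V} [G.LocallyFinite] (Φ : PlanarSkeletonFrmFrom G) (t : V) (p : unitInterval) (D : DataNS V) (g : ℕ) (f : ℕ) (mx : ℕ) : 2 * (nL κ Φ t p D g f + ℓL κ Φ t p D g f + 3 * (hL κ Φ t p D g f).natAbs + 1) * (50 * (fcellsA κ Φ t p D g f).rmax + 1) ≤ mRS κ Φ t p D g f mx ∧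
    mx ≤ mRS κ Φ t p D g f mx := ⟨le_max_left _ _, le_max_right _ _⟩

/-- **FINE DIAMETER ⇒ φ-DIAMETER** for the (ζ′) cells: fine coordinates (map slot `φ′`) within `50·fcellsA.rmax` on both axes give `φ′ d − φ′ d' ∈ box 2 (mRS mx)`. [folklore] -/
theorem fine_diam_le_mRS (κ : Consts) {V : Type} [DecidableEq V] [Countable V] {G : SimpleGraph V} [G.LocallyFinite] (Φ : PlanarSkeletonFrmFrom G) (t : V) (p : unitInterval) (D : DataNS V) (g : ℕ) (f : ℕ) (mx : ℕ) (hN : EqNumL κ Φ t p D g f) {φ' : V → Site 2} {d d' : V}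
    (h : fineA κ Φ t p D g f φ' d - fineA κ Φ t p D g f φ' d' ∈ box 2 (50 * (fcellsA κ Φ t p D g f).rmax)) : φ' d - φ' d' ∈ box 2 (mRS κ Φ t p D g f mx) := by
  rw [mem_box] at h ⊢
  intro i
  have hρ : ∀ j, |fineA κ Φ t p D g f φ' d j - fineA κ Φ t p D g f φ' d' j| ≤ ((50 * (fcellsA κ Φ t p D g f).rmax : ℕ) : ℤ) := fun j => by
    have hj := h j
    rw [Pi.sub_apply] at hj
    exact abs_le.2 hj
  have hK := (φ_extent_fineA_at κ Φ t p D g f hN (Nat.cast_nonneg _) hρ i).2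
  have hm : ((2 * (nL κ Φ t p D g f + ℓL κ Φ t p D g f + 3 * (hL κ Φ t p D g f).natAbs + 1) * (50 * (fcellsA κ Φ t p D g f).rmax + 1) : ℕ) : ℤ) ≤
      (mRS κ Φ t p D g f mx : ℤ) := by
    exact_mod_cast (mRS_ge κ Φ t p D g f mx).1
  have h2 : 2 * ((nL κ Φ t p D g f : ℤ) + ℓL κ Φ t p D g f + 3 * |hL κ Φ t p D g f| + 1) * (((50 * (fcellsA κ Φ t p D g f).rmax : ℕ) : ℤ) + 1) =
      ((2 * (nL κ Φ t p D g f + ℓL κ Φ t p D g f + 3 * (hL κ Φ t p D g f).natAbs + 1) * (50 * (fcellsA κ Φ t p D g f).rmax + 1) : ℕ) : ℤ) := by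
    push_cast; ring
  rw [Pi.sub_apply]
  exact abs_le.1 (hK.trans (h2 ▸ hm))

end Values

/-! ## §2 The fibre block of record over the staggered cells -/

/-- **THE FIBRE BLOCK OF RECORD OF THE (ζ′) CHAIN**: `⟨max fcellsA.rmax (cOffS+1), 1, 0, ψπ, 0, ex κ Φ t p D g f, NegB.Rex (mRS … (mx …)) q⟩`.
[cite: KozmaNitzan2024, §4 Theorem 6 (pp. 25–31): the order of constants] -/
def SUS (ex mx : GSlot) : SSlot := fun κ _ _ _ _ _ Φ t p D g f q =>
  ⟨max (fcellsA κ Φ t p D g f).rmax (cOffS κ Φ t p D g f + 1), 1, 0, ψπ Φ p D, 0, ex κ Φ t p D g f, Rex κ Φ (mRS κ Φ t p D g f (mx κ Φ t p D g f)) q⟩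

section Facts

variable (κ : Consts) {V : Type} [DecidableEq V] [Countable V] {G : SimpleGraph V} [G.LocallyFinite] (Φ : PlanarSkeletonFrmFrom G) (t : V)
  (p : unitInterval) (D : DataNS V) (g f : ℕ) (ex mx : GSlot) (q : unitInterval)

/-- The fields of `SUS` (all `rfl`). [folklore] -/
theorem SUS_fields (κ : Consts) {V : Type} [DecidableEq V] [Countable V] {G : SimpleGraph V} [G.LocallyFinite] (Φ : PlanarSkeletonFrmFrom G) (t : V) (p : unitInterval) (D : DataNS V) (g : ℕ) (f : ℕ) (ex : GSlot) (mx : GSlot) (q : unitInterval) : (SUS ex mx κ Φ t p D g f q).rmax = max (fcellsA κ Φ t p D g f).rmax (cOffS κ Φ t p D g f + 1) ∧ (SUS ex mx κ Φ t p D g f q).u = 1 ∧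
    (SUS ex mx κ Φ t p D g f q).M = 0 ∧ (SUS ex mx κ Φ t p D g f q).ψM = ψπ Φ p D ∧ (SUS ex mx κ Φ t p D g f q).ψtop = 0 ∧ (SUS ex mx κ Φ t p D g f q).reachK = ex κ Φ t p D g f ∧
    (SUS ex mx κ Φ t p D g f q).Rex = Rex κ Φ (mRS κ Φ t p D g f (mx κ Φ t p D g f)) q :=
  ⟨rfl, rfl, rfl, rfl, rfl, rfl, rfl⟩

/-- `fcellsA.rmax ≤ rmax` and `cOffS + 1 ≤ rmax`. [folklore] -/
theorem SUS_rmax_ge (κ : Consts) {V : Type} [DecidableEq V] [Countable V] {G : SimpleGraph V} [G.LocallyFinite] (Φ : PlanarSkeletonFrmFrom G) (t : V) (p : unitInterval) (D : DataNS V) (g : ℕ) (f : ℕ) (ex : GSlot) (mx : GSlot) (q : unitInterval) : (fcellsA κ Φ t p D g f).rmax ≤ (SUS ex mx κ Φ t p D g f q).rmax ∧ cOffS κ Φ t p D g f + 1 ≤ (SUS ex mx κ Φ t p D g f q).rmax :=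
  ⟨le_max_left _ _, le_max_right _ _⟩

/-- **`20·fcellsA.rmax ≤ gap ρ`**. [folklore] -/
theorem hgap20_US (κ : Consts) {V : Type} [DecidableEq V] [Countable V] {G : SimpleGraph V} [G.LocallyFinite] (Φ : PlanarSkeletonFrmFrom G) (t : V) (p : unitInterval) (D : DataNS V) (g : ℕ) (f : ℕ) (ex : GSlot) (mx : GSlot) (q : unitInterval) (ρ : ℕ) : 20 * (fcellsA κ Φ t p D g f).rmax ≤ Skelφ.Prm.gap (SUS ex mx κ Φ t p D g f q) ρ :=
  le_trans (Nat.mul_le_mul_left _ (SUS_rmax_ge κ Φ t p D g f ex mx q).1) (Skelφ.Prm.twenty_rmax_le_gap _ ρ)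

/-- **`cOffS ≤ gap ρ`**. [folklore] -/
theorem hgapc_US (κ : Consts) {V : Type} [DecidableEq V] [Countable V] {G : SimpleGraph V} [G.LocallyFinite] (Φ : PlanarSkeletonFrmFrom G) (t : V) (p : unitInterval) (D : DataNS V) (g : ℕ) (f : ℕ) (ex : GSlot) (mx : GSlot) (q : unitInterval) (ρ : ℕ) : cOffS κ Φ t p D g f ≤ Skelφ.Prm.gap (SUS ex mx κ Φ t p D g f q) ρ := by
  have h1 := (SUS_rmax_ge κ Φ t p D g f ex mx q).2
  have h2 := Skelφ.Prm.dG_le_gap (SUS ex mx κ Φ t p D g f q) ρ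
  exact le_trans (le_trans (le_trans (Nat.le_succ _) h1) (Nat.le_mul_of_pos_left _ (by norm_num))) h2

/-- **`cOffS + 2L′ + Rex ρ + 2 ≤ gap ρ`**. [folklore] -/
theorem hgapR_US (κ : Consts) {V : Type} [DecidableEq V] [Countable V] {G : SimpleGraph V} [G.LocallyFinite] (Φ : PlanarSkeletonFrmFrom G) (t : V) (p : unitInterval) (D : DataNS V) (g : ℕ) (f : ℕ) (ex : GSlot) (mx : GSlot) (q : unitInterval) (ρ : ℕ) : cOffS κ Φ t p D g f + 2 * Skelφ.Prm.Lp (SUS ex mx κ Φ t p D g f q) + Rex κ Φ (mRS κ Φ t p D g f (mx κ Φ t p D g f)) q ρ + 2 ≤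
    Skelφ.Prm.gap (SUS ex mx κ Φ t p D g f q) ρ := by
  rw [Skelφ.Prm.gap_eq]
  have h1 : cOffS κ Φ t p D g f + 1 ≤ (SUS ex mx κ Φ t p D g f q).rmax := (SUS_rmax_ge κ Φ t p D g f ex mx q).2
  have h2 : Rex κ Φ (mRS κ Φ t p D g f (mx κ Φ t p D g f)) q ρ ≤ (SUS ex mx κ Φ t p D g f q).Rex (ρ + 1) := Rex_mono κ Φ _ q (Nat.le_succ ρ)
  generalize (SUS ex mx κ Φ t p D g f q).rmax = R at h1 ⊢
  generalize (SUS ex mx κ Φ t p D g f q).Rex (ρ + 1) = X at h2 ⊢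
  generalize Skelφ.Prm.Lp (SUS ex mx κ Φ t p D g f q) = L
  omega

/-- `L′ ≤ gap ρ`. [folklore] -/
theorem hgapL_US (κ : Consts) {V : Type} [DecidableEq V] [Countable V] {G : SimpleGraph V} [G.LocallyFinite] (Φ : PlanarSkeletonFrmFrom G) (t : V) (p : unitInterval) (D : DataNS V) (g : ℕ) (f : ℕ) (ex : GSlot) (mx : GSlot) (q : unitInterval) (ρ : ℕ) : Skelφ.Prm.Lp (SUS ex mx κ Φ t p D g f q) ≤ Skelφ.Prm.gap (SUS ex mx κ Φ t p D g f q) ρ := Skelφ.Prm.hgapL _ ρ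

/-- **`ex ≤ L′ ≤ E₀`**. [folklore] -/
theorem ex_le_Lp_US (κ : Consts) {V : Type} [DecidableEq V] [Countable V] {G : SimpleGraph V} [G.LocallyFinite] (Φ : PlanarSkeletonFrmFrom G) (t : V) (p : unitInterval) (D : DataNS V) (g : ℕ) (f : ℕ) (ex : GSlot) (mx : GSlot) (q : unitInterval) : ex κ Φ t p D g f ≤ Skelφ.Prm.Lp (SUS ex mx κ Φ t p D g f q) ∧ Skelφ.Prm.Lp (SUS ex mx κ Φ t p D g f q) ≤ Skelφ.Prm.E₀ (SUS ex mx κ Φ t p D g f q) := by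
  refine ⟨?_, Skelφ.Prm.Lp_le_E₀ _⟩
  have h := Skelφ.Prm.reachK_le_Lp (SUS ex mx κ Φ t p D g f q)
  exact h

/-- `3 ≤ E₀`, indeed `45·fcellsA.rmax ≤ E₀`. [folklore] -/
theorem three_le_E₀_US (κ : Consts) {V : Type} [DecidableEq V] [Countable V] {G : SimpleGraph V} [G.LocallyFinite] (Φ : PlanarSkeletonFrmFrom G) (t : V) (p : unitInterval) (D : DataNS V) (g : ℕ) (f : ℕ) (ex : GSlot) (mx : GSlot) (q : unitInterval) : 3 ≤ Skelφ.Prm.E₀ (SUS ex mx κ Φ t p D g f q) ∧ 45 * (fcellsA κ Φ t p D g f).rmax ≤ Skelφ.Prm.E₀ (SUS ex mx κ Φ t p D g f q) := by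
  have h1 := Skelφ.Prm.planar_le_E₀ (SUS ex mx κ Φ t p D g f q)
  have h2 := (SUS_rmax_ge κ Φ t p D g f ex mx q).1
  have h3 : 1 ≤ (fcellsA κ Φ t p D g f).rmax := le_trans ((fcellsA κ Φ t p D g f).one_le_r 0) ((fcellsA κ Φ t p D g f).r_le_rmax 0)
  have h4 : 45 * (fcellsA κ Φ t p D g f).rmax ≤ Skelφ.Prm.E₀ (SUS ex mx κ Φ t p D g f q) :=
    le_trans (le_trans (Nat.mul_le_mul_left 45 h2) (Nat.le_add_right _ _)) h1
  exact ⟨le_trans (le_trans (by norm_num : 3 ≤ 45 * 1) (Nat.mul_le_mul_left 45 h3)) h4, h4⟩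

/-- **`hsch`**: `Rex (E g' + 1) + L′ ≤ E (g'+1)` for `E := Erad gap 0 E₀`. [folklore] -/
theorem hsch_US (κ : Consts) {V : Type} [DecidableEq V] [Countable V] {G : SimpleGraph V} [G.LocallyFinite] (Φ : PlanarSkeletonFrmFrom G) (t : V) (p : unitInterval) (D : DataNS V) (g : ℕ) (f : ℕ) (ex : GSlot) (mx : GSlot) (q : unitInterval) (g' : ℕ) : Rex κ Φ (mRS κ Φ t p D g f (mx κ Φ t p D g f)) q (Erad (Skelφ.Prm.gap (SUS ex mx κ Φ t p D g f q)) (fun _ => 0) (Skelφ.Prm.E₀ (SUS ex mx κ Φ t p D g f q)) g' + 1) +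
      Skelφ.Prm.Lp (SUS ex mx κ Φ t p D g f q) ≤ Erad (Skelφ.Prm.gap (SUS ex mx κ Φ t p D g f q)) (fun _ => 0) (Skelφ.Prm.E₀ (SUS ex mx κ Φ t p D g f q)) (g' + 1) := by
  have h := Skelφ.Prm.hsch (SUS ex mx κ Φ t p D g f q) g'
  exact le_trans (Nat.add_le_add_right (Nat.le_add_right _ _) _) h

/-- `Rex` at the value is monotone. [folklore] -/
theorem Rex_mono_US (κ : Consts) {V : Type} [DecidableEq V] [Countable V] {G : SimpleGraph V} [G.LocallyFinite] (Φ : PlanarSkeletonFrmFrom G) (t : V) (p : unitInterval) (D : DataNS V) (g : ℕ) (f : ℕ) (ex : GSlot) (mx : GSlot) (q : unitInterval) : Monotone (SUS ex mx κ Φ t p D g f q).Rex := Rex_monotone κ Φ _ q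

/-- **`hR₁` at the value** (depth `ρ+1`, any centre, either orientation, any `η' ≥ η`, planar diameter `mRS`), consumer's instance. [folklore] -/
theorem hR₁_US (κ : Consts) {V : Type} [DecidableEq V] [Countable V] {G : SimpleGraph V} [G.LocallyFinite] (Φ : PlanarSkeletonFrmFrom G) (t : V) (p : unitInterval) (D : DataNS V) (g : ℕ) (f : ℕ) (ex : GSlot) (mx : GSlot) (q : unitInterval) (hC : Φ.CylSubcritical q) (o : Bool) {η' : ℝ} (hη' : Neg.η κ Φ ≤ η') (c : V) :
    ∀ ρ R', (SUS ex mx κ Φ t p D g f q).Rex ρ ≤ R' → ∀ (Rw : ℕ) (D' A' : Finset V), (∀ d ∈ D', d ∈ graphBall G c Rw) →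
      (∀ d ∈ D', ∀ d' ∈ D', oriφ Φ.φ o d - oriφ Φ.φ o d' ∈ box 2 (mRS κ Φ t p D g f (mx κ Φ t p D g f))) → A' ⊆ D' → (∀ a ∈ A', a ∈ graphBall G c (ρ + 1)) →
        (bondPercolation G q).real (excess G c R' D' A') ≤ η' := by
  have hη'' : @Neg.η κ V (fun a b => Classical.propDecidable (a = b)) _ G _ Φ ≤ η' := by convert hη' using 2
  exact hR₁_at κ Φ (mRS κ Φ t p D g f (mx κ Φ t p D g f)) hC o hη'' c

/-- **`hRex` at the value** (depth `R₀'`), consumer's instance. [folklore] -/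
theorem hRex_US (κ : Consts) {V : Type} [DecidableEq V] [Countable V] {G : SimpleGraph V} [G.LocallyFinite] (Φ : PlanarSkeletonFrmFrom G) (t : V) (p : unitInterval) (D : DataNS V) (g : ℕ) (f : ℕ) (ex : GSlot) (mx : GSlot) (q : unitInterval) (hC : Φ.CylSubcritical q) (o : Bool) {η' : ℝ} (hη' : Neg.η κ Φ ≤ η') (c : V) :
    ∀ R₀' R₁, (SUS ex mx κ Φ t p D g f q).Rex R₀' ≤ R₁ → ∀ (Rw : ℕ) (D' A' : Finset V), (∀ d ∈ D', d ∈ graphBall G c Rw) →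
      (∀ d ∈ D', ∀ d' ∈ D', oriφ Φ.φ o d - oriφ Φ.φ o d' ∈ box 2 (mRS κ Φ t p D g f (mx κ Φ t p D g f))) → A' ⊆ D' → (∀ a ∈ A', a ∈ graphBall G c R₀') →
        (bondPercolation G q).real (excess G c R₁ D' A') ≤ η' := by
  have hη'' : @Neg.η κ V (fun a b => Classical.propDecidable (a = b)) _ G _ Φ ≤ η' := by convert hη' using 2
  exact hRex_at κ Φ (mRS κ Φ t p D g f (mx κ Φ t p D g f)) hC o hη'' c

/-- `hR₁` at the value with `η' := η`. [folklore] -/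
theorem hR₁_US_η (κ : Consts) {V : Type} [DecidableEq V] [Countable V] {G : SimpleGraph V} [G.LocallyFinite] (Φ : PlanarSkeletonFrmFrom G) (t : V) (p : unitInterval) (D : DataNS V) (g : ℕ) (f : ℕ) (ex : GSlot) (mx : GSlot) (q : unitInterval) (hC : Φ.CylSubcritical q) (o : Bool) (c : V) :
    ∀ ρ R', (SUS ex mx κ Φ t p D g f q).Rex ρ ≤ R' → ∀ (Rw : ℕ) (D' A' : Finset V), (∀ d ∈ D', d ∈ graphBall G c Rw) →
      (∀ d ∈ D', ∀ d' ∈ D', oriφ Φ.φ o d - oriφ Φ.φ o d' ∈ box 2 (mRS κ Φ t p D g f (mx κ Φ t p D g f))) → A' ⊆ D' → (∀ a ∈ A', a ∈ graphBall G c (ρ + 1)) →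
        (bondPercolation G q).real (excess G c R' D' A') ≤ Neg.η κ Φ :=
  hR₁_US κ Φ t p D g f ex mx q hC o le_rfl c

/-- **`E₀ (SUS …) = ex + Rex κ Φ mRS q (2·ψπ) + 69·rmax′ + 4·ψπ + 48`** (`rmax′ := max fcellsA.rmax (cOffS+1)`). [folklore] -/
theorem E₀_SUS_eq (κ : Consts) {V : Type} [DecidableEq V] [Countable V] {G : SimpleGraph V} [G.LocallyFinite] (Φ : PlanarSkeletonFrmFrom G) (t : V) (p : unitInterval) (D : DataNS V) (g : ℕ) (f : ℕ) (ex : GSlot) (mx : GSlot) (q : unitInterval) : Skelφ.Prm.E₀ (SUS ex mx κ Φ t p D g f q) =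
    ex κ Φ t p D g f + Rex κ Φ (mRS κ Φ t p D g f (mx κ Φ t p D g f)) q (2 * ψπ Φ p D) + 69 * max (fcellsA κ Φ t p D g f).rmax (cOffS κ Φ t p D g f + 1) + 4 * ψπ Φ p D + 48 := by
  show Skelφ.Prm.Lp _ + 45 * max (fcellsA κ Φ t p D g f).rmax (cOffS κ Φ t p D g f + 1) + ψπ Φ p D = _
  unfold Skelφ.Prm.Lp Skelφ.Prm.LA Skelφ.Prm.dL
  show 24 * max (fcellsA κ Φ t p D g f).rmax (cOffS κ Φ t p D g f + 1) + 2 * (0 + ψπ Φ p D) + Rex κ Φ (mRS κ Φ t p D g f (mx κ Φ t p D g f)) q (2 * ψπ Φ p D) +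
      (24 * 1 + 8 * 0 + 12) + 0 + ψπ Φ p D + 12 * 1 + 2 * 0 + ex κ Φ t p D g f + 45 * max (fcellsA κ Φ t p D g f).rmax (cOffS κ Φ t p D g f + 1) + ψπ Φ p D = _
  ring

/-- `L′ (SUS …) = ex + Rex(2ψπ) + 24·rmax′ + 3·ψπ + 48`. [folklore] -/
theorem Lp_SUS_eq (κ : Consts) {V : Type} [DecidableEq V] [Countable V] {G : SimpleGraph V} [G.LocallyFinite] (Φ : PlanarSkeletonFrmFrom G) (t : V) (p : unitInterval) (D : DataNS V) (g : ℕ) (f : ℕ) (ex : GSlot) (mx : GSlot) (q : unitInterval) : Skelφ.Prm.Lp (SUS ex mx κ Φ t p D g f q) =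
    ex κ Φ t p D g f + Rex κ Φ (mRS κ Φ t p D g f (mx κ Φ t p D g f)) q (2 * ψπ Φ p D) + 24 * max (fcellsA κ Φ t p D g f).rmax (cOffS κ Φ t p D g f + 1) + 3 * ψπ Φ p D + 48 := by
  unfold Skelφ.Prm.Lp Skelφ.Prm.LA Skelφ.Prm.dL
  show 24 * max (fcellsA κ Φ t p D g f).rmax (cOffS κ Φ t p D g f + 1) + 2 * (0 + ψπ Φ p D) + Rex κ Φ (mRS κ Φ t p D g f (mx κ Φ t p D g f)) q (2 * ψπ Φ p D) +
      (24 * 1 + 8 * 0 + 12) + 0 + ψπ Φ p D + 12 * 1 + 2 * 0 + ex κ Φ t p D g f = _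
  ring

end Facts

/-! ## §3 The root radius `Rπ := E₀ − 1` (any block) and the four root radii at the schedule of record -/

section RootRadii

variable (κ : Consts) {V : Type} [DecidableEq V] [Countable V] {G : SimpleGraph V} [G.LocallyFinite] (Φ : PlanarSkeletonFrmFrom G) (t : V)
  (p : unitInterval) (D : DataNS V) (g f : ℕ) (c : Fin 2 → ℕ) (Sv : SSlot) (q : unitInterval)

/-- **THE ROOT RADIUS OF RECORD** `Rπ := E₀ (Sv … q) − 1` (p3-g9's slot `Rπ` of `rootOblTWAt_negBS_x/_y`; bound under `AtQO O q`, so it may read `q`). [this work] -/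
def Rπ (κ : Consts) {V : Type} [DecidableEq V] [Countable V] {G : SimpleGraph V} [G.LocallyFinite] (Φ : PlanarSkeletonFrmFrom G) (t : V) (p : unitInterval) (D : DataNS V) (g : ℕ) (f : ℕ) (Sv : SSlot) (q : unitInterval) : ℕ := Skelφ.Prm.E₀ (Sv κ Φ t p D g f q) - 1

/-- `Rπ + 1 = E₀`. [folklore] -/
theorem Rπ_succ (κ : Consts) {V : Type} [DecidableEq V] [Countable V] {G : SimpleGraph V} [G.LocallyFinite] (Φ : PlanarSkeletonFrmFrom G) (t : V) (p : unitInterval) (D : DataNS V) (g : ℕ) (f : ℕ) (Sv : SSlot) (q : unitInterval) : Rπ κ Φ t p D g f Sv q + 1 = Skelφ.Prm.E₀ (Sv κ Φ t p D g f q) := by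
  have := PlanarSkeletonNeg.NegB.twelve_le_E₀ (Sv κ Φ t p D g f q); unfold Rπ; omega

/-- **`hRQ`**: `Rπ + 1 ≤ rQ 0 0` (`rQ 0 0 = E (nQ 0 0) ⊔ … ≥ E₀`). [folklore] -/
theorem hRQ_RS (κ : Consts) {V : Type} [DecidableEq V] [Countable V] {G : SimpleGraph V} [G.LocallyFinite] (Φ : PlanarSkeletonFrmFrom G) (t : V) (p : unitInterval) (D : DataNS V) (g : ℕ) (f : ℕ) (c : Fin 2 → ℕ) (Sv : SSlot) (q : unitInterval) : Rπ κ Φ t p D g f Sv q + 1 ≤ (schedOfS κ Φ t p D g f c (Sv κ Φ t p D g f q)).rQ 0 0 := by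
  rw [Rπ_succ]
  show _ ≤ max (Erad (Skelφ.Prm.gap (Sv κ Φ t p D g f q)) (fun _ => 0) (Skelφ.Prm.E₀ (Sv κ Φ t p D g f q)) (nQ 0 0)) _
  exact le_trans (Skel.E₀_le_Erad _ _ _ _) (le_max_left _ _)

/-- **`hRB`**: `Rπ + 1 ≤ rB 0 0 du` (`= E (nQ 0 (0+du))`). [folklore] -/
theorem hRB_RS (κ : Consts) {V : Type} [DecidableEq V] [Countable V] {G : SimpleGraph V} [G.LocallyFinite] (Φ : PlanarSkeletonFrmFrom G) (t : V) (p : unitInterval) (D : DataNS V) (g : ℕ) (f : ℕ) (c : Fin 2 → ℕ) (Sv : SSlot) (q : unitInterval) (du : MDir) : Rπ κ Φ t p D g f Sv q + 1 ≤ (schedOfS κ Φ t p D g f c (Sv κ Φ t p D g f q)).rB 0 0 du := by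
  rw [Rπ_succ]
  show _ ≤ Erad (Skelφ.Prm.gap (Sv κ Φ t p D g f q)) (fun _ => 0) (Skelφ.Prm.E₀ (Sv κ Φ t p D g f q)) (nQ 0 (0 + stepVec du))
  exact Skel.E₀_le_Erad _ _ _ _

/-- **`hRQ′`**: `Rπ + 1 ≤ rQ 0 (0 + du)`. [folklore] -/
theorem hRQ'_RS (κ : Consts) {V : Type} [DecidableEq V] [Countable V] {G : SimpleGraph V} [G.LocallyFinite] (Φ : PlanarSkeletonFrmFrom G) (t : V) (p : unitInterval) (D : DataNS V) (g : ℕ) (f : ℕ) (c : Fin 2 → ℕ) (Sv : SSlot) (q : unitInterval) (du : MDir) : Rπ κ Φ t p D g f Sv q + 1 ≤ (schedOfS κ Φ t p D g f c (Sv κ Φ t p D g f q)).rQ 0 ((0 : Site 2) + stepVec du) := by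
  rw [Rπ_succ]
  show _ ≤ max (Erad (Skelφ.Prm.gap (Sv κ Φ t p D g f q)) (fun _ => 0) (Skelφ.Prm.E₀ (Sv κ Φ t p D g f q)) (nQ 0 ((0 : Site 2) + stepVec du))) _
  exact le_trans (Skel.E₀_le_Erad _ _ _ _) (le_max_left _ _)

/-- **`hRM`**: `Rπ + 1 ≤ rM 0 (0 + du)` (`rM 0 (0+du) = F 1 − L′ = E₀ + gap E₀ − L′ ≥ E₀` since `L′ ≤ gap`). [folklore] -/
theorem hRM_RS (κ : Consts) {V : Type} [DecidableEq V] [Countable V] {G : SimpleGraph V} [G.LocallyFinite] (Φ : PlanarSkeletonFrmFrom G) (t : V) (p : unitInterval) (D : DataNS V) (g : ℕ) (f : ℕ) (c : Fin 2 → ℕ) (Sv : SSlot) (q : unitInterval) (du : MDir) : Rπ κ Φ t p D g f Sv q + 1 ≤ (schedOfS κ Φ t p D g f c (Sv κ Φ t p D g f q)).rM 0 ((0 : Site 2) + stepVec du) := by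
  rw [Rπ_succ]
  show _ ≤ Frad (Skelφ.Prm.gap (Sv κ Φ t p D g f q)) (fun _ => 0) (Skelφ.Prm.E₀ (Sv κ Φ t p D g f q)) (nQ 0 ((0 : Site 2) + stepVec du)) - Skelφ.Prm.Lp (Sv κ Φ t p D g f q)
  rw [Skel.nQ_zero_stepVec, BoxProdZ2.Frad_succ, BoxProdZ2.Erad_zero]
  have h := Skelφ.Prm.hgapL (Sv κ Φ t p D g f q) (Skelφ.Prm.E₀ (Sv κ Φ t p D g f q))
  omega

/-- `X + 1 ≤ E₀ → X ≤ Rπ`. [folklore] -/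
theorem le_Rπ_of (κ : Consts) {V : Type} [DecidableEq V] [Countable V] {G : SimpleGraph V} [G.LocallyFinite] (Φ : PlanarSkeletonFrmFrom G) (t : V) (p : unitInterval) (D : DataNS V) (g : ℕ) (f : ℕ) (Sv : SSlot) (q : unitInterval) {X : ℕ} (h : X + 1 ≤ Skelφ.Prm.E₀ (Sv κ Φ t p D g f q)) : X ≤ Rπ κ Φ t p D g f Sv q := by
  unfold Rπ; omega

/-- `X + 1 ≤ reachK → X ≤ Rπ` (`reachK ≤ L′ ≤ E₀`). [folklore] -/
theorem le_Rπ_of_reachK (κ : Consts) {V : Type} [DecidableEq V] [Countable V] {G : SimpleGraph V} [G.LocallyFinite] (Φ : PlanarSkeletonFrmFrom G) (t : V) (p : unitInterval) (D : DataNS V) (g : ℕ) (f : ℕ) (Sv : SSlot) (q : unitInterval) {X : ℕ} (h : X + 1 ≤ (Sv κ Φ t p D g f q).reachK) : X ≤ Rπ κ Φ t p D g f Sv q :=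
  le_Rπ_of κ Φ t p D g f Sv q (le_trans h (le_trans (Skelφ.Prm.reachK_le_Lp _) (Skelφ.Prm.Lp_le_E₀ _)))

end RootRadii

/-! ## §4 The `Rπ`-inequalities of the root residue at `SUS`, as floors on `ex` -/

section RootSU

variable (κ : Consts) {V : Type} [DecidableEq V] [Countable V] {G : SimpleGraph V} [G.LocallyFinite] (Φ : PlanarSkeletonFrmFrom G) (t : V)
  (p : unitInterval) (D : DataNS V) (g f : ℕ) (ex mx : GSlot) (q : unitInterval)

/-- **`X + 1 ≤ ex → X ≤ Rπ`** (p3's `hRlπ hπ1 hπ2 hRb₀ hRr₀ hRbπ`: each a floor on `ex`). [folklore] -/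
theorem ex_le_Rπ (κ : Consts) {V : Type} [DecidableEq V] [Countable V] {G : SimpleGraph V} [G.LocallyFinite] (Φ : PlanarSkeletonFrmFrom G) (t : V) (p : unitInterval) (D : DataNS V) (g : ℕ) (f : ℕ) (ex : GSlot) (mx : GSlot) (q : unitInterval) {X : ℕ} (h : X + 1 ≤ ex κ Φ t p D g f) : X ≤ Rπ κ Φ t p D g f (SUS ex mx) q :=
  le_Rπ_of_reachK κ Φ t p D g f (SUS ex mx) q h

/-- **`hρπ`**: `fatRadius Φ.frame hC D.k ≤ Rπ` (`ψπ + 1 ≤ E₀`). [folklore] -/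
theorem fat_le_Rπ (κ : Consts) {V : Type} [DecidableEq V] [Countable V] {G : SimpleGraph V} [G.LocallyFinite] (Φ : PlanarSkeletonFrmFrom G) (t : V) (p : unitInterval) (D : DataNS V) (g : ℕ) (f : ℕ) (ex : GSlot) (mx : GSlot) (q : unitInterval) (hC : Φ.CylSubcritical p) : Skelφ.fatRadius Φ.frame hC D.k ≤ Rπ κ Φ t p D g f (SUS ex mx) q := by
  refine le_Rπ_of κ Φ t p D g f (SUS ex mx) q ?_
  rw [← ψπ_eq Φ hC D, E₀_SUS_eq]; omega

/-- **`hR₁b/hR₁r`**: `r₀ + 1 ≤ ex → Rex κ Φ mR q (fatRadius Φ.frame hC D.k) ≤ Rπ − r₀` (`Rex` monotone in the depth, `fatRadius k ≤ 2ψπ`, `Rex(2ψπ) + ex − 1 ≤ E₀ − 1`).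
[cite: KozmaNitzan2024, §4 Lemma 12 (p. 24)] -/
theorem Rex_fat_le_Rπ_sub (κ : Consts) {V : Type} [DecidableEq V] [Countable V] {G : SimpleGraph V} [G.LocallyFinite] (Φ : PlanarSkeletonFrmFrom G) (t : V) (p : unitInterval) (D : DataNS V) (g : ℕ) (f : ℕ) (ex : GSlot) (mx : GSlot) (q : unitInterval) (hC : Φ.CylSubcritical p) {r₀ : ℕ} (h : r₀ + 1 ≤ ex κ Φ t p D g f) :
    Rex κ Φ (mRS κ Φ t p D g f (mx κ Φ t p D g f)) q (Skelφ.fatRadius Φ.frame hC D.k) ≤ Rπ κ Φ t p D g f (SUS ex mx) q - r₀ := by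
  have h1 : Rex κ Φ (mRS κ Φ t p D g f (mx κ Φ t p D g f)) q (Skelφ.fatRadius Φ.frame hC D.k) ≤ Rex κ Φ (mRS κ Φ t p D g f (mx κ Φ t p D g f)) q (2 * ψπ Φ p D) :=
    Rex_mono κ Φ _ q (by rw [ψπ_eq Φ hC D]; omega)
  have h2 := Rπ_succ κ Φ t p D g f (SUS ex mx) q
  rw [E₀_SUS_eq] at h2
  omega

/-- The same with the schedule's own `Rex` field (`(SUS …).Rex = Rex κ Φ mR q`). [folklore] -/
theorem SRex_fat_le_Rπ_sub (κ : Consts) {V : Type} [DecidableEq V] [Countable V] {G : SimpleGraph V} [G.LocallyFinite] (Φ : PlanarSkeletonFrmFrom G) (t : V) (p : unitInterval) (D : DataNS V) (g : ℕ) (f : ℕ) (ex : GSlot) (mx : GSlot) (q : unitInterval) (hC : Φ.CylSubcritical p) {r₀ : ℕ} (h : r₀ + 1 ≤ ex κ Φ t p D g f) :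
    (SUS ex mx κ Φ t p D g f q).Rex (Skelφ.fatRadius Φ.frame hC D.k) ≤ Rπ κ Φ t p D g f (SUS ex mx) q - r₀ :=
  Rex_fat_le_Rπ_sub κ Φ t p D g f ex mx q hC h

end RootSU

end NegB

end PlanarSkeletonFrmFrom

end Summit.CriticalPhenomena.PercolationContinuityZ3.Theorems.Transplant

end
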